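import Summits.AtomisticToContinuum.Crystallization.Theorems.FreeSplittingCertificatesStrictSplittingRuleP1DemandBare
import Summits.AtomisticToContinuum.Crystallization.Theorems.FreeSplittingCertificatesStrictSplittingRuleP1CellVarianceF

/-!
# `StrictSplittingRule` (stmt-AtomisticToContinuum-12560): the GLOBAL bare-demand transfer with a POINTWISE weight majorant, and the JENSEN (credit) direction (P1 interpolant object, part 29)

Route `FreeSplittingCertificates`, crux r3 `StrictSplittingRule` (H12⋆ = `stub_coreJointCoercive`), unit b2b-freesplit-B gen 24.
VALUE = two assembly-facing companions of part 27 (`tsum_p1SiteBare_le`, HOME FAR-LEMMA-SPEC §17 (e),(h)):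
* **`tsum_p1SiteBare_le_fun`** — the inner-edge-safe global form of the radial-deficit transfer: for a continuous weight
  `0 ⪯ W(y)` with a continuous POINTWISE majorant `q_{W(y)}(u) ≤ ω(y)|u|²` (in the assembly `ω = 2χ²|y|⁻⁸`, the same `χ²` as the
  readout density, so that no `χ`-ratio appears), lattice values `V` with interpolant `ṽ = p1Field a h V`:
  `Σ'_q p1SiteBare q ≤ ∫ q_W(ṽ) + ¼·Σ'_T (∫_T ω)·p1CellEdgeEnergy V T`
  (sum of `vertex_quadrature_excess_fun_p1RealCell` over the cells + the cell-vertex → site regrouping);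
* **`integral_quad_p1Field_le_tsum_p1SiteBare`** — the JENSEN direction (`C = 1` exactly, no defect): for `0 ⪯ W(y)`,
  `∫ q_W(ṽ) ≤ Σ'_q p1SiteBare q` — the matched lattice credit dominates the continuum credit of the interpolant
  (pointwise `p1_jensen_quad` on each cell, cells decomposition, regrouping).
Hypotheses (integrability of `q_W(ṽ)`, summability of the defect / vertex families) are discharged in the assembly from the
decay of the weights.  NOT a proof of H12⋆, NOT summit progress.  [folklore]
-/

noncomputable section

open Set Function Metric MeasureTheory Filter Topology
open scoped BigOperators NNReal ENNReal

namespace Summit.AtomisticToContinuum.Crystallization.Theorems.StrictSplittingRuleBirth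

/-- **THE GLOBAL BARE-DEMAND TRANSFER WITH A POINTWISE WEIGHT MAJORANT (matched split, radial-deficit half, inner-edge form).**
For a continuous weight `W`, positive semidefinite, with a continuous pointwise majorant `q_{W(y)}(u) ≤ ω(y)|u|²`, lattice values
`V` with interpolant `ṽ = p1Field a h V`, assuming `q_W(ṽ)` integrable and the defect family summable:
`Σ'_q p1SiteBare q ≤ ∫ q_W(ṽ) + ¼·Σ'_T (∫_T ω)·p1CellEdgeEnergy V T`.  NOT a proof of H12⋆, NOT summit progress. -/
theorem tsum_p1SiteBare_le_fun {a h : ℝ} (ha : 0 < a) (hh : 0 < h) (W : (Fin 3 → ℝ) → Fin 3 → Fin 3 → ℝ)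
    (hWc : ∀ k l, Continuous fun x => W x k l) (hW0 : ∀ y : Fin 3 → ℝ, ∀ u : Fin 3 → ℝ, 0 ≤ p1Quad3 (W y) u)
    {ω : (Fin 3 → ℝ) → ℝ} (hωc : Continuous ω)
    (hω : ∀ y : Fin 3 → ℝ, ∀ u : Fin 3 → ℝ, p1Quad3 (W y) u ≤ ω y * (u 0 ^ 2 + u 1 ^ 2 + u 2 ^ 2))
    (V : ℤ × ℤ × ℤ → (Fin 3 → ℝ)) (hint : Integrable fun y => p1Quad3 (W y) (p1Field a h V y))
    (hdef : Summable fun i => (∫ y in p1RealCell a h i, ω y) * p1CellEdgeEnergy V i) :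
    Summable (p1SiteBare a h W V) ∧
    ∑' q, p1SiteBare a h W V q ≤
      (∫ y, p1Quad3 (W y) (p1Field a h V y)) + 1 / 4 * ∑' i, (∫ y in p1RealCell a h i, ω y) * p1CellEdgeEnergy V i := by
  have ha' := ha.ne'
  have hh' := hh.ne'
  -- per-cell inequality
  have hcell : ∀ i, ∑ m, p1CellBare a h W V i m ≤
      (∫ y in p1RealCell a h i, p1Quad3 (W y) (p1Field a h V y)) +
        1 / 4 * ((∫ y in p1RealCell a h i, ω y) * p1CellEdgeEnergy V i) := by
    intro i
    have h1 := vertex_quadrature_excess_fun_p1RealCell ha hh i W hWc (fun y _ u => hW0 y u) hωc (fun y _ u => hω y u)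
      (p1CellVals V i)
    have h2 : ∫ y in p1RealCell a h i, p1Quad3 (W y) (fun k => ∑ m, p1Lam a h i m y * p1CellVals V i m k) =
        ∫ y in p1RealCell a h i, p1Quad3 (W y) (p1Field a h V y) :=
      setIntegral_congr_fun (isClosed_p1RealCell a h i).measurableSet fun y hy => by rw [p1Field_eq_sum_p1Lam V hy]
    unfold p1CellBare p1CellEdgeEnergy
    rw [← h2]
    linarith
  -- the three families
  have hB : HasSum (fun i => ∫ y in p1RealCell a h i, p1Quad3 (W y) (p1Field a h V y)) (∫ y, p1Quad3 (W y) (p1Field a h V y)) :=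
    hasSum_setIntegral_p1RealCell ha' hh' hint
  have hA0 : ∀ i, 0 ≤ ∑ m, p1CellBare a h W V i m := fun i => Finset.sum_nonneg fun m _ => p1CellBare_nonneg V i (fun y _ u => hW0 y u) m
  have hdef' : Summable fun i => 1 / 4 * ((∫ y in p1RealCell a h i, ω y) * p1CellEdgeEnergy V i) := hdef.mul_left _
  have hsum : Summable fun i => (∫ y in p1RealCell a h i, p1Quad3 (W y) (p1Field a h V y)) +
      1 / 4 * ((∫ y in p1RealCell a h i, ω y) * p1CellEdgeEnergy V i) := hB.summable.add hdef'
  have hA : Summable fun i => ∑ m, p1CellBare a h W V i m := Summable.of_nonneg_of_le hA0 hcell hsum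
  -- regroup the vertex family to sites
  have hg0 : ∀ n π m, 0 ≤ p1CellBare a h W V (n, π) m := fun n π m => p1CellBare_nonneg V (n, π) (fun y _ u => hW0 y u) m
  have hAf : HasSum (fun n : ℤ × ℤ × ℤ => ∑ π : Fin 6, ∑ m : Fin 4, p1CellBare a h W V (n, π) m) (∑' i, ∑ m, p1CellBare a h W V i m) :=
    hA.hasSum.prod_fiberwise fun n => hasSum_fintype _
  obtain ⟨hS, hEq⟩ := tsum_cellVertex_eq_tsum_site (g := fun n π m => p1CellBare a h W V (n, π) m) hg0 hAf.summable
  have hSite : (fun q => ∑ o ∈ p1Corners, ∑ π : Fin 6, ∑ m : Fin 4,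
      if p1VertOff (p1Par (q - o)) π m = o then p1CellBare a h W V (q - o, π) m else 0) = p1SiteBare a h W V := by
    funext q; rfl
  rw [hSite] at hS hEq
  refine ⟨hS, ?_⟩
  rw [← hEq, hAf.tsum_eq]
  calc ∑' i, ∑ m, p1CellBare a h W V i m
      ≤ ∑' i, ((∫ y in p1RealCell a h i, p1Quad3 (W y) (p1Field a h V y)) +
          1 / 4 * ((∫ y in p1RealCell a h i, ω y) * p1CellEdgeEnergy V i)) :=
        Summable.tsum_le_tsum hcell hA hsum
    _ = (∑' i, ∫ y in p1RealCell a h i, p1Quad3 (W y) (p1Field a h V y)) +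
          ∑' i, 1 / 4 * ((∫ y in p1RealCell a h i, ω y) * p1CellEdgeEnergy V i) :=
        hB.summable.tsum_add hdef'
    _ = (∫ y, p1Quad3 (W y) (p1Field a h V y)) + 1 / 4 * ∑' i, (∫ y in p1RealCell a h i, ω y) * p1CellEdgeEnergy V i := by
        rw [hB.tsum_eq, tsum_mul_left]

/-- **Jensen on one cell, integrated**: for `0 ⪯ W(y)` (continuous) and vertex values `v`,
`∫_T q_W(Σ_m λ_m v_m) ≤ Σ_m ∫_T λ_m·q_W(v_m)`. -/
theorem setIntegral_quad_le_sum_p1Lam {a h : ℝ} (ha : 0 < a) (hh : 0 < h) (i : (ℤ × ℤ × ℤ) × Fin 6)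
    (W : (Fin 3 → ℝ) → Fin 3 → Fin 3 → ℝ) (hWc : ∀ k l, Continuous fun x => W x k l)
    (hW0 : ∀ y ∈ p1RealCell a h i, ∀ u : Fin 3 → ℝ, 0 ≤ p1Quad3 (W y) u) (v : Fin 4 → Fin 3 → ℝ) :
    (∫ y in p1RealCell a h i, p1Quad3 (W y) (fun k => ∑ m, p1Lam a h i m y * v m k)) ≤
      ∑ m, ∫ y in p1RealCell a h i, p1Lam a h i m y * p1Quad3 (W y) (v m) := by
  have hK := isCompact_p1RealCell ha.ne' hh.ne' i
  have hmeas : MeasurableSet (p1RealCell a h i) := (isClosed_p1RealCell a h i).measurableSet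
  have hcl : ∀ m, Continuous (p1Lam a h i m) := continuous_p1Lam a h i
  have hq : ∀ u : Fin 3 → ℝ, Continuous fun y => p1Quad3 (W y) u := fun u =>
    continuous_p1Quad3_of_continuous hWc (u := fun _ => u) fun k => continuous_const
  have iA : ∀ m, IntegrableOn (fun y => p1Lam a h i m y * p1Quad3 (W y) (v m)) (p1RealCell a h i) volume := fun m =>
    ((hcl m).mul (hq _)).continuousOn.integrableOn_compact hK
  have iQ : IntegrableOn (fun y => p1Quad3 (W y) (fun k => ∑ m, p1Lam a h i m y * v m k)) (p1RealCell a h i) volume := by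
    have : Continuous fun y => p1Quad3 (W y) (fun k => ∑ m, p1Lam a h i m y * v m k) := by
      refine continuous_p1Quad3_of_continuous hWc fun k => ?_
      simp only [Fin.sum_univ_four]
      fun_prop
    exact this.continuousOn.integrableOn_compact hK
  have iS : IntegrableOn (fun y => ∑ m, p1Lam a h i m y * p1Quad3 (W y) (v m)) (p1RealCell a h i) volume :=
    integrable_finsetSum _ fun m _ => iA m
  rw [← integral_finsetSum _ fun m _ => iA m]
  refine setIntegral_mono_on iQ iS hmeas fun y hy => ?_
  exact p1_jensen_quad (W y) (hW0 y hy) (fun m => p1Lam a h i m y) (fun m => p1Lam_nonneg_of_mem hy m) (sum_p1Lam_eq_one a h i y) v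

/-- **THE JENSEN (CREDIT) DIRECTION OF THE MATCHED SPLIT** (`C = 1`, no defect).  For a continuous weight `0 ⪯ W(y)`, lattice values
`V` with interpolant `ṽ = p1Field a h V`, assuming `q_W(ṽ)` integrable and the vertex family summable:
`∫ q_W(ṽ) ≤ Σ'_q p1SiteBare q` — the continuum credit of the interpolant is dominated by the matched lattice credit.
NOT a proof of H12⋆, NOT summit progress. -/
theorem integral_quad_p1Field_le_tsum_p1SiteBare {a h : ℝ} (ha : 0 < a) (hh : 0 < h) (W : (Fin 3 → ℝ) → Fin 3 → Fin 3 → ℝ)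
    (hWc : ∀ k l, Continuous fun x => W x k l) (hW0 : ∀ y : Fin 3 → ℝ, ∀ u : Fin 3 → ℝ, 0 ≤ p1Quad3 (W y) u)
    (V : ℤ × ℤ × ℤ → (Fin 3 → ℝ)) (hint : Integrable fun y => p1Quad3 (W y) (p1Field a h V y))
    (hsum : Summable fun i => ∑ m, p1CellBare a h W V i m) :
    Summable (p1SiteBare a h W V) ∧
    (∫ y, p1Quad3 (W y) (p1Field a h V y)) ≤ ∑' q, p1SiteBare a h W V q := by
  have ha' := ha.ne'
  have hh' := hh.ne'
  -- per-cell Jensen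
  have hcell : ∀ i, (∫ y in p1RealCell a h i, p1Quad3 (W y) (p1Field a h V y)) ≤ ∑ m, p1CellBare a h W V i m := by
    intro i
    have h1 := setIntegral_quad_le_sum_p1Lam ha hh i W hWc (fun y _ u => hW0 y u) (p1CellVals V i)
    have h2 : ∫ y in p1RealCell a h i, p1Quad3 (W y) (fun k => ∑ m, p1Lam a h i m y * p1CellVals V i m k) =
        ∫ y in p1RealCell a h i, p1Quad3 (W y) (p1Field a h V y) :=
      setIntegral_congr_fun (isClosed_p1RealCell a h i).measurableSet fun y hy => by rw [p1Field_eq_sum_p1Lam V hy]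
    unfold p1CellBare
    rw [← h2]
    exact h1
  have hB : HasSum (fun i => ∫ y in p1RealCell a h i, p1Quad3 (W y) (p1Field a h V y)) (∫ y, p1Quad3 (W y) (p1Field a h V y)) :=
    hasSum_setIntegral_p1RealCell ha' hh' hint
  -- regroup the vertex family to sites
  have hg0 : ∀ n π m, 0 ≤ p1CellBare a h W V (n, π) m := fun n π m => p1CellBare_nonneg V (n, π) (fun y _ u => hW0 y u) m
  have hAf : HasSum (fun n : ℤ × ℤ × ℤ => ∑ π : Fin 6, ∑ m : Fin 4, p1CellBare a h W V (n, π) m) (∑' i, ∑ m, p1CellBare a h W V i m) :=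
    hsum.hasSum.prod_fiberwise fun n => hasSum_fintype _
  obtain ⟨hS, hEq⟩ := tsum_cellVertex_eq_tsum_site (g := fun n π m => p1CellBare a h W V (n, π) m) hg0 hAf.summable
  have hSite : (fun q => ∑ o ∈ p1Corners, ∑ π : Fin 6, ∑ m : Fin 4,
      if p1VertOff (p1Par (q - o)) π m = o then p1CellBare a h W V (q - o, π) m else 0) = p1SiteBare a h W V := by
    funext q; rfl
  rw [hSite] at hS hEq
  refine ⟨hS, ?_⟩
  rw [← hEq, hAf.tsum_eq, ← hB.tsum_eq]
  exact Summable.tsum_le_tsum hcell hB.summable hsum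

end Summit.AtomisticToContinuum.Crystallization.Theorems.StrictSplittingRuleBirth
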